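import Summits.NavierStokesRegularity.NavierStokesRegularity.Theses.SlicedKelvin
import Summits.NavierStokesRegularity.NavierStokesRegularity.Theorems.BlowupAssembly
import Summits.NavierStokesRegularity.NavierStokesRegularity.Theorems.BlowupBlowupClayNonuniquenessRefutation
import Summits.NavierStokesRegularity.NavierStokesRegularity.Theorems.RungReynoldsOne.Negative.WithoutLerayHopfFalse
import Literature.Analysis.FluidPDE.NSQuasipotential
import Summits.NavierStokesRegularity.NavierStokesRegularity.Theorems.SlicedKelvinFluxZoomStubSubslabBounds
import Summits.NavierStokesRegularity.NavierStokesRegularity.Theorems.SlicedKelvinPlanarFluxLiouvilleStubIrrotationalConstant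
import Summits.NavierStokesRegularity.NavierStokesRegularity.Theorems.FluxZoom.Negative.StubFluxVelocityFalseWithoutL2

/-!
# Disproof of `FluxZoom` — findings (crux stmt-NavierStokesRegularity-15603, route SlicedKelvin)

Refuter crux-attack workfile (seat `refuter-rattack-stmt-NavierStokesRegularity-15603-0`, gen 1,
2026-08-17; extended by the cdisprove seat `refuter-cdisprove-stmt-NavierStokesRegularity-15603-0`, §5).
`lean check` rc 0, 0 sorry; every theorem has axioms ⊆ {propext, Classical.choice, Quot.sound}.

## Verdict: SURVIVES (no kill is possible short of the Millennium problem) — but read §1: the crux is PURE GLUE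

THE CRUX (readback of `Theses.SlicedKelvin.FluxZoom`): `∀ ν T > 0, ∀ (u,p)`: classical NS on
`[0,T) × ℝ³` → Leray–Hopf on `[0,T]` from `u 0` → `u 0` rapidly decaying → NO smooth extension past `T` →
planar flux of `curl (u t)` bounded by `M` on `[0,T)` (all planes `R{x₂=c}`, all `R : ℝ³ ≃ₗᵢ ℝ³`, all `c`) →
`∃ v M'`: bounded ancient duality-mild solution (`ν = 1`), measurable slices, jointly `C^∞` on `(−∞,0) × ℝ³`,
planar flux `≤ M'` on every plane and every slice `t < 0`, and SOME slice `t < 0` not spatially constant.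

§1 STRUCTURE (the decisive observation). The conclusion `∃ v M', …` mentions NONE of `ν, T, u, p, M`: it is
the closed proposition `ZoomWitness` below, and `ZoomWitness ↔ ¬ PlanarFluxLiouville` (crux 3 of the same
route, stmt-15601) is a one-line rearrangement (`zoomWitness_iff_not_planarFluxLiouville`). Hence, with
`BoundedFluxNoBlowup` := the second conjunct of the route's `Target` (stmt-15599) verbatim:

* `fluxZoom_iff` : `FluxZoom ↔ (PlanarFluxLiouville → BoundedFluxNoBlowup)`;
* `fluxZoom_of_not_planarFluxLiouville` : `¬ PlanarFluxLiouville → FluxZoom` (if crux 3 dies, crux 4 is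
  TRIVIALLY true and carries no information);
* `not_fluxZoom_iff` : `¬ FluxZoom ↔ (PlanarFluxLiouville ∧ ¬ BoundedFluxNoBlowup)` — a refutation of this
  crux must PROVE the flux-class Liouville theorem AND exhibit a finite-time blow-up from rapidly decaying
  data with bounded planar flux (a negative solution of Clay (A), `not_navierStokesRegularity_of_not_fluxZoom`);
* `closes_hypotheses_iff` : `(PlanarFluxLiouville ∧ FluxZoom) ↔ (PlanarFluxLiouville ∧ BoundedFluxNoBlowup)`,
  `target_iff` : `Target ↔ PlanarFluxAPriori ∧ BoundedFluxNoBlowup` — so the route's deciding theorem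
  `closes h₁ h₂ h₃` consumes exactly `Target ∧ PlanarFluxLiouville`; the ZOOM MECHANISM of the informal
  text (v = vorticity-clock blow-up limit of `u`, `M' = M/ν`, `|curl v| ≥ 1/2` somewhere) is NOT encoded in
  the formal statement — it is one PROOF STRATEGY for the bare implication, the statement being weaker
  (hence easier) than the mechanism. Not a defect for a glue item; recorded so that nobody tries to
  refute `FluxZoom` by attacking compactness bookkeeping: bookkeeping failures break the PROOF, never the
  STATEMENT.

§2 RESTATES-THE-SUMMIT PROBES. `S → C` HOLDS, kernel-checked: `fluxZoom_of_navierStokesRegularity :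
NavierStokesRegularity → FluxZoom` (Clay (A) ⇒ no blow-up from Schwartz data, via the tree theorems
`Literature.NS.blowup_assembly` + `Theorems.BlowupBlowupClayNonuniqueness_refuted` (X5b, Tao 2013
Cor. 11.4) ⇒ the no-extension hypothesis is unsatisfiable ⇒ `FluxZoom` vacuously). In fact
`navierStokesRegularity_iff_noBlowup` (with the PROVED `NoBlowupToClay`, stmt-0055). `C → S` is NOT
derivable (and must not be: `C` follows from `¬ PlanarFluxLiouville`, which does not decide (A)); automation
probes (`exact?`/`aesop`/`simp` on `FluxZoom`, `FluxZoom → NavierStokesRegularity`) fail — folder `Probes.lean`.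

§3 LOAD-BEARING HYPOTHESES (modulo crux 3 — the only possible form, by §1). Dropping a hypothesis on `u`
can only matter through SATISFIABILITY of the antecedent, and each dropped variant collapses to
`ZoomWitness = ¬ PlanarFluxLiouville`:
* `fluxZoomWithoutLerayHopf_iff` : drop `IsLerayHopfOn` ⇒ `↔ ZoomWitness` — witness of the antecedent: the
  KNSS parasitic drift `u = gI(t)·e₀`, `p = −gI′(t) x₀`, `gI(t) = (1−t)^{-1/2} − 1` on `[0,1)` (classical, datum
  `0`, curl ≡ 0 so planar flux `0 ≤ M`, no classical extension past `T = 1`; tree file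
  `Theorems/RungReynoldsOne/Negative/WithoutLerayHopfFalse.lean`);
* `fluxZoomWithoutNoExtension_iff` : drop `¬ HasSmoothExtensionPast` ⇒ `↔ ZoomWitness` — the rest state
  `u ≡ 0` satisfies everything else;
* `fluxZoomWithoutFluxBound_iff` : drop the flux bound on `u` ⇒ `↔ (PlanarFluxLiouville → NoBlowup)`, i.e. the
  flux-class Liouville theorem would have to deliver FULL regularity (no flux inheritance possible).
So `IsLerayHopfOn`, `¬HasSmoothExtensionPast` and the flux bound are each load-bearing GIVEN crux 3, and
nothing about `FluxZoom` is testable without deciding crux 3 or Clay (A): no finite/certified-compute falsifier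
exists (the statement has no finite shadow).

§4 JUNK AUDIT (readback, no finding): `∫⁻` (no Bochner junk) of `‖⟪curl(u t)(R(y₀,y₁,c)), R e₂⟫‖ₑ` over
`EuclideanSpace ℝ (Fin 2)` — honest unsigned flux through the plane `R{x₂ = c}` with unit normal `R e₂`,
`R` over ALL linear isometries (reflections harmless), `e₂ = single 2 1`; `M < 0` forces `curl u ≡ 0` on
`[0,T)` (then `u(t)` is harmonic and `L²`, so `u ≡ 0`, which extends: antecedent unsatisfiable, harmless);
`(⊤ : ℕ∞)` coerces to `C^∞` (not `C^ω`); `IsBoundedAncientMildSolution 1 v` = weakly div-free slices +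
two-time duality identity against div-free tests (Bochner integrals, but HONEST here because `v` is bounded
and jointly smooth) + `‖v‖ ≤ C` on `t < 0`; the class contains the parasitic drifts `b(t)` and their
Galilean composites, all of which are slice-wise constant or boosts of genuine mild solutions, so a junk
`ZoomWitness` would be a genuine bounded ancient NON-CONSTANT very weak solution with planar-`L¹` vorticity
= a counterexample to crux 3 (none known; KNSS conjecture (L) territory). Quantifier order `∃ M ∀ t ∀ R ∀ c`
(uniform) as in the informal text. The measurability conjunct of the conclusion is implied by the joint
smoothness conjunct (`aestronglyMeasurable_slice_of_contDiffOn`) — redundant, harmless.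
§5 LINE `registered` (cdisprove seat `refuter-cdisprove-stmt-NavierStokesRegularity-15603-0`, gen 1, cycle 1,
2026-08-17; the lead's reshaped 7-stub skeleton `Cruxes/FluxZoom/Lines/birth.lean`, sha `aad79edc…`).
Stub-by-stub verdict (details in the §5 docstrings below):
* `stub_subslabBounds` — LANDED (p148680). `stub_nearFieldFlux` — LANDED (p150680); constants re-derived:
  inner ball `4πrW`, shell `Σᵢ Φ·∫_{-2}^{2} min(h⁻²,r⁻²) dh = 3Φ(4/r − 1) ≤ 12Φ/r` ✓.
* `stub_unitScaleVelocity` — TRUE on paper (local Helmholtz identity; near field `(4π)⁻¹(4πrW + 12Φ/r) =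
  rW + 3Φ/(πr)` ✓). Its `L²` hypothesis / `C_v‖v‖₂` term is LOAD-BEARING: `stub_unitScaleVelocity_false_without_L2`
  (constant field `e₀`, `W = Φ = 0`, `r = 1`: `1 ≤ 0`). LANDED: `Theorems/FluxZoom/Negative/
  StubFluxVelocityFalseWithoutL2.lean` (p151529, accepted).
* `stub_fluxVelocity` — TRUE on paper (pure scaling `v ↦ ℓv(x+ℓ·)`: `W ↦ ℓ²W`, `Φ ↦ Φ`, `‖v‖₂ ↦ ℓ^{-1/2}‖v‖₂`;
  `min_ρ (ρW + 3Φ/(πρ))² = 12WΦ/π` ✓, degenerate `W = 0`/`Φ = 0` consistent since an `L²` harmonic field is `0`).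
  `L²` LOAD-BEARING and NOT replaceable by boundedness: `stub_fluxVelocity_false_without_L2`,
  `stub_fluxVelocity_false_with_bounded_for_L2` (same witness) — so the bound `‖v‖²_∞ ≤ (12/π)‖ω‖_∞Φ*` can only
  be fed to the slices `u(t) ∈ L²` BEFORE rescaling, never to the bounded ancient limit (p151529).
* `stub_oseenBoxRegularity` — = tree fact `KNSS2009_mild_regularity` (PROVED, `KNSS2009_mild_regularity_holds`:
  SAME shape, constants `C L : ℕ → ℝ → ℝ` chosen from `N, T` only ✓ uniform in `V`) + joint smoothness from
  `KNSS2009_prop41_mild_holds`, once `IsKNSSDriftMild T N (1_{(0,T)}V) 0` is built from the stub's hypotheses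
  (bounded continuous `V` ⇒ every Bochner integral in `heatExtension`/`oseenDuhamel` is honest — no junk model).
* `stub_oseenAncientMild` — duality class readback: `IsBoundedAncientMildSolution 1 V = IsAncientMildSolution ∧
  IsBoundedOn (Iio 0) V` quantifies ONLY over `t < 0` and `s < t < 0` (no `t = 0` loophole: `V 0` unconstrained on
  both sides ✓); Oseen ⇒ duality by testing, pattern `IsTypeIAncientMild.isMildNSSolutionBetween`. No attack.
* `stub_zoomCore` — GLUE-SHAPED like the crux: its conclusion is `u`-free (`ZoomWitnessCurl`), so with
  `StubZoomCoreU` := its `u`-part (antecedents S4–S6 = statements of stubs 4–6, all true):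
  `stubZoomCoreU_iff : StubZoomCoreU ↔ (BoundedFluxVorticityBlowup → ZoomWitnessCurl)`,
  `zoomWitnessCurl_iff_zoomWitness` (KNSS Lemma 3.1 = landed `stub_irrotationalConstant`), hence
  `not_stubZoomCoreU_iff : ¬StubZoomCoreU ↔ (BoundedFluxVorticityBlowup ∧ PlanarFluxLiouville)` — unkillable
  short of a finite-time vorticity blow-up from Schwartz-class data PLUS crux 3; and
  `boundedFluxVorticityBlowup_of_not_boundedFluxNoBlowup` (landed stub 1(a)) / `fluxZoom_of_stubZoomCoreU`
  re-certify the composition. Its extra `u`-hypotheses: sub-slab bounds = landed stub 1(b) (convenience, not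
  load-bearing: `stubZoomCoreU_iff_without_subslab`); `¬∃W` load-bearing modulo crux 3 (rest state, as §3).
* Crux hypothesis `0 < T` is DECORATION: `hasSmoothExtensionPast_of_nonpos` (`T ≤ 0` ⇒ every `u` extends), so
  `¬HasSmoothExtensionPast ν 0 u T → 0 < T` (`pos_of_not_hasSmoothExtensionPast`).
No kill; no stub broken; 1 Negative file landed (p151529, 3 lemmas).
-/

noncomputable section

namespace Summit.NavierStokesRegularity.NavierStokesRegularity.Cruxes.FluxZoom.Disproof

set_option linter.dupNamespace false

open Set MeasureTheory Filter Topology Function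
open Literature.Analysis.FluidPDE
open Summit.NavierStokesRegularity.NavierStokesRegularity.Theses.SlicedKelvin
open Summit.NavierStokesRegularity.NavierStokesRegularity.Theorems.RungReynoldsOneNegative

local notation "ℝ³" => EuclideanSpace ℝ (Fin 3)
local notation "ℝ²" => EuclideanSpace ℝ (Fin 2)

/-! ## §0 The three closed propositions the crux is made of -/

/-- `BoundedFluxNoBlowup`: the SECOND CONJUNCT of the route target `Theses.SlicedKelvin.Target`
(stmt-15599), verbatim — a classical Leray–Hopf solution from a rapidly decaying datum whose planar flux
stays bounded on `[0,T)` extends smoothly past `T`. -/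
def BoundedFluxNoBlowup : Prop :=
  ∀ (ν T : ℝ), 0 < ν → 0 < T → ∀ (u : ℝ → EuclideanSpace ℝ (Fin 3) → EuclideanSpace ℝ (Fin 3))
    (p : ℝ → EuclideanSpace ℝ (Fin 3) → ℝ),
    Literature.Analysis.FluidPDE.IsClassicalNSSolutionOn (Set.Ico 0 T) ν 0 u p →
    Literature.Analysis.FluidPDE.IsLerayHopfOn T ν 0 (u 0) u →
    Literature.Analysis.FluidPDE.HasRapidSpatialDecay (u 0) →
    (∃ M : ℝ, ∀ t ∈ Set.Ico 0 T, ∀ (R : EuclideanSpace ℝ (Fin 3) ≃ₗᵢ[ℝ] EuclideanSpace ℝ (Fin 3)) (c : ℝ),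
      ∫⁻ y : EuclideanSpace ℝ (Fin 2),
        ‖inner ℝ (Literature.Analysis.FluidPDE.curl (u t) (R (WithLp.toLp 2 ![y 0, y 1, c])))
          (R (EuclideanSpace.single 2 1))‖ₑ ≤ ENNReal.ofReal M) →
    Literature.Analysis.FluidPDE.HasSmoothExtensionPast ν 0 u T

/-- `NoBlowup`: the antecedent of the route's (PROVED) `NoBlowupToClay` (stmt-0055), verbatim. -/
def NoBlowup : Prop :=
  ∀ (ν T : ℝ), 0 < ν → 0 < T → ∀ (u : ℝ → EuclideanSpace ℝ (Fin 3) → EuclideanSpace ℝ (Fin 3))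
    (p : ℝ → EuclideanSpace ℝ (Fin 3) → ℝ),
    Literature.Analysis.FluidPDE.IsClassicalNSSolutionOn (Set.Ico 0 T) ν 0 u p →
    Literature.Analysis.FluidPDE.IsLerayHopfOn T ν 0 (u 0) u →
    Literature.Analysis.FluidPDE.HasRapidSpatialDecay (u 0) →
    Literature.Analysis.FluidPDE.HasSmoothExtensionPast ν 0 u T

/-- `ZoomWitness`: the CONCLUSION of `FluxZoom`, verbatim — a closed proposition (no `u`, `ν`, `T`, `M`). -/
def ZoomWitness : Prop :=
  ∃ (v : ℝ → EuclideanSpace ℝ (Fin 3) → EuclideanSpace ℝ (Fin 3)) (M' : ℝ),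
    Literature.Analysis.FluidPDE.IsBoundedAncientMildSolution 1 v ∧
    (∀ t < 0, MeasureTheory.AEStronglyMeasurable (v t) MeasureTheory.volume) ∧
    ContDiffOn ℝ (⊤ : ℕ∞) (Function.uncurry v) (Set.Iio 0 ×ˢ Set.univ) ∧
    (∀ t < 0, ∀ (R : EuclideanSpace ℝ (Fin 3) ≃ₗᵢ[ℝ] EuclideanSpace ℝ (Fin 3)) (c : ℝ),
      ∫⁻ y : EuclideanSpace ℝ (Fin 2),
        ‖inner ℝ (Literature.Analysis.FluidPDE.curl (v t) (R (WithLp.toLp 2 ![y 0, y 1, c])))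
          (R (EuclideanSpace.single 2 1))‖ₑ ≤ ENNReal.ofReal M') ∧
    ∃ t < 0, ¬ ∃ b : EuclideanSpace ℝ (Fin 3), ∀ x, v t x = b

/-! ## §1 Structure: the crux is literally the glue `PlanarFluxLiouville → BoundedFluxNoBlowup` -/

/-- The route target splits as crux 2 ∧ `BoundedFluxNoBlowup` (definitional). -/
theorem target_iff : Target ↔ (PlanarFluxAPriori ∧ BoundedFluxNoBlowup) := Iff.rfl

/-- **The conclusion of `FluxZoom` is exactly the negation of crux 3** (`PlanarFluxLiouville`). -/
theorem zoomWitness_iff_not_planarFluxLiouville : ZoomWitness ↔ ¬ PlanarFluxLiouville := by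
  constructor
  · rintro ⟨v, M', hv, hmeas, hsm, hflux, t, ht, hnc⟩ hL
    exact hnc (hL v hv hmeas hsm ⟨M', hflux⟩ t ht)
  · intro hL
    by_contra hZ
    apply hL
    intro v hv hmeas hsm hflux t ht
    obtain ⟨M', hM'⟩ := hflux
    by_contra hb
    exact hZ ⟨v, M', hv, hmeas, hsm, hM', t, ht, hb⟩

/-- `FluxZoom` unfolded: "a bounded-flux blow-up anywhere ⇒ `ZoomWitness`". -/
theorem fluxZoom_iff_not_boundedFluxNoBlowup_imp : FluxZoom ↔ (¬ BoundedFluxNoBlowup → ZoomWitness) := by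
  constructor
  · intro hZ hB
    by_contra hW
    apply hB
    intro ν T hν hT u p hcl hLH hdec hflux
    by_contra hne
    exact hW (hZ ν T hν hT u p hcl hLH hdec hne hflux)
  · intro h ν T hν hT u p hcl hLH hdec hne hflux
    exact h fun hB => hne (hB ν T hν hT u p hcl hLH hdec hflux)

/-- **`FluxZoom ↔ (PlanarFluxLiouville → BoundedFluxNoBlowup)`**: the crux is the bare glue implication
"crux 3 ⇒ second half of the target"; nothing of the zoom survives in the statement. -/
theorem fluxZoom_iff : FluxZoom ↔ (PlanarFluxLiouville → BoundedFluxNoBlowup) := by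
  rw [fluxZoom_iff_not_boundedFluxNoBlowup_imp, zoomWitness_iff_not_planarFluxLiouville]
  constructor
  · intro h hL
    by_contra hB
    exact h hB hL
  · intro h hB hL
    exact hB (h hL)

/-- If crux 3 is false, crux 4 holds trivially (its witness serves every `u`). -/
theorem fluxZoom_of_not_planarFluxLiouville (h : ¬ PlanarFluxLiouville) : FluxZoom :=
  fluxZoom_iff.2 fun hL => absurd hL h

/-- `BoundedFluxNoBlowup` alone gives `FluxZoom` (vacuity of the no-extension hypothesis). -/
theorem fluxZoom_of_boundedFluxNoBlowup (h : BoundedFluxNoBlowup) : FluxZoom :=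
  fluxZoom_iff.2 fun _ => h

/-- **What a refutation must deliver**: crux 3 proved AND a bounded-flux blow-up exhibited. -/
theorem not_fluxZoom_iff : ¬ FluxZoom ↔ (PlanarFluxLiouville ∧ ¬ BoundedFluxNoBlowup) := by
  rw [fluxZoom_iff]
  tauto

/-- The hypotheses of the route's deciding theorem `closes h₁ h₂ h₃`, minus `h₁`, are exactly
`PlanarFluxLiouville ∧ BoundedFluxNoBlowup`. -/
theorem closes_hypotheses_iff :
    (PlanarFluxLiouville ∧ FluxZoom) ↔ (PlanarFluxLiouville ∧ BoundedFluxNoBlowup) := by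
  rw [fluxZoom_iff]
  exact ⟨fun ⟨hL, h⟩ => ⟨hL, h hL⟩, fun ⟨hL, hB⟩ => ⟨hL, fun _ => hB⟩⟩

/-- Hence `closes` consumes exactly `Target ∧ PlanarFluxLiouville`. -/
theorem closes_hypotheses_iff' :
    (PlanarFluxAPriori ∧ PlanarFluxLiouville ∧ FluxZoom) ↔ (Target ∧ PlanarFluxLiouville) := by
  rw [target_iff, fluxZoom_iff]
  exact ⟨fun ⟨hA, hL, h⟩ => ⟨⟨hA, h hL⟩, hL⟩, fun ⟨⟨hA, hB⟩, hL⟩ => ⟨hA, hL, fun _ => hB⟩⟩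

/-! ## §2 Restates-the-summit probes: `S → C` holds (kernel-checked); `C → S` only through crux 3 -/

/-- **Clay (A) ⇒ no blow-up from rapidly decaying data**, from tree theorems only: a maximal smooth
Leray–Hopf solution from a Schwartz-type datum (`X5a`) plus uniqueness of class-(A) solutions against it
(`X5b`, PROVED: `Theorems.BlowupBlowupClayNonuniqueness_refuted`) contradicts (A)
(`Literature.NS.blowup_assembly`). -/
theorem noBlowup_of_navierStokesRegularity (hA : _root_.NavierStokesRegularity) : NoBlowup := by
  intro ν T hν hT u p hcl hLH hdec
  by_contra hext
  exact Literature.NS.blowup_assembly ⟨⟨ν, hν, T, hT, u, p, ⟨hcl, hext⟩, hLH, hdec⟩, not_not.1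
    Summit.NavierStokesRegularity.NavierStokesRegularity.Theorems.BlowupBlowupClayNonuniqueness_refuted⟩ hA

/-- With the PROVED `NoBlowupToClay` (stmt-0055): **`NavierStokesRegularity ↔ NoBlowup`** in tree. -/
theorem navierStokesRegularity_iff_noBlowup : _root_.NavierStokesRegularity ↔ NoBlowup :=
  ⟨noBlowup_of_navierStokesRegularity, fun h =>
    (_root_.Summit.NavierStokesRegularity.NavierStokesRegularity.Theorems.typeICertificateLadder_noBlowupToClay_proof :
      NoBlowupToClay) h⟩

/-- `NoBlowup ⇒ BoundedFluxNoBlowup` (drop the flux hypothesis). -/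
theorem boundedFluxNoBlowup_of_noBlowup (h : NoBlowup) : BoundedFluxNoBlowup :=
  fun ν T hν hT u p hcl hLH hdec _ => h ν T hν hT u p hcl hLH hdec

/-- **`S → C`**: the summit implies the crux (every no-blow-up glue is a consequence of (A)). -/
theorem fluxZoom_of_navierStokesRegularity (hA : _root_.NavierStokesRegularity) : FluxZoom :=
  fluxZoom_of_boundedFluxNoBlowup (boundedFluxNoBlowup_of_noBlowup (noBlowup_of_navierStokesRegularity hA))

/-- Contrapositive: **any refutation of `FluxZoom` refutes Clay (A)** — the crux cannot be closed
`refuted` without a negative solution of the Millennium problem. -/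
theorem not_navierStokesRegularity_of_not_fluxZoom (h : ¬ FluxZoom) : ¬ _root_.NavierStokesRegularity :=
  fun hA => h (fluxZoom_of_navierStokesRegularity hA)

/-- … and ALSO proves crux 3 (so a refuter of crux 4 settles crux 3 positively on the way). -/
theorem planarFluxLiouville_of_not_fluxZoom (h : ¬ FluxZoom) : PlanarFluxLiouville :=
  (not_fluxZoom_iff.1 h).1

/-! ## §3 Load-bearing hypotheses — every dropped variant collapses to `ZoomWitness = ¬ crux 3` -/

/-- The curl of a spatially constant field vanishes. -/
theorem curl_const (b x : ℝ³) : Literature.Analysis.FluidPDE.curl (fun _ => b) x = 0 := by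
  ext i
  fin_cases i <;> simp [Literature.Analysis.FluidPDE.curl]

/-- The planar flux of a spatially constant slice is `0 ≤ ofReal M` for every `M`. -/
theorem flux_const_le (b : ℝ³) (R : ℝ³ ≃ₗᵢ[ℝ] ℝ³) (c M : ℝ) :
    ∫⁻ y : ℝ², ‖inner ℝ (Literature.Analysis.FluidPDE.curl (fun _ : ℝ³ => b) (R (WithLp.toLp 2 ![y 0, y 1, c])))
        (R (EuclideanSpace.single 2 1))‖ₑ ≤ ENNReal.ofReal M := by
  simp [curl_const]

/-- `FluxZoom` with the Leray–Hopf hypothesis DROPPED. -/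
def FluxZoomWithoutLerayHopf : Prop :=
  ∀ (ν T : ℝ), 0 < ν → 0 < T → ∀ (u : ℝ → EuclideanSpace ℝ (Fin 3) → EuclideanSpace ℝ (Fin 3))
    (p : ℝ → EuclideanSpace ℝ (Fin 3) → ℝ),
    Literature.Analysis.FluidPDE.IsClassicalNSSolutionOn (Set.Ico 0 T) ν 0 u p →
    Literature.Analysis.FluidPDE.HasRapidSpatialDecay (u 0) →
    ¬ Literature.Analysis.FluidPDE.HasSmoothExtensionPast ν 0 u T →
    (∃ M : ℝ, ∀ t ∈ Set.Ico 0 T, ∀ (R : EuclideanSpace ℝ (Fin 3) ≃ₗᵢ[ℝ] EuclideanSpace ℝ (Fin 3)) (c : ℝ),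
      ∫⁻ y : EuclideanSpace ℝ (Fin 2),
        ‖inner ℝ (Literature.Analysis.FluidPDE.curl (u t) (R (WithLp.toLp 2 ![y 0, y 1, c])))
          (R (EuclideanSpace.single 2 1))‖ₑ ≤ ENNReal.ofReal M) →
    ZoomWitness

/-- **The parasitic drift passes every hypothesis of `FluxZoom` except Leray–Hopf**, at `ν = T = 1`:
classical on `[0,1)`, zero (rapidly decaying) datum, no classical extension past `1`, planar flux `≡ 0`. -/
theorem drift_passes (M : ℝ) :
    Literature.Analysis.FluidPDE.IsClassicalNSSolutionOn (Set.Ico 0 1) 1 0 (drift (gI 1)) (driftP (gI 1)) ∧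
    Literature.Analysis.FluidPDE.HasRapidSpatialDecay (drift (gI 1) 0) ∧
    ¬ Literature.Analysis.FluidPDE.HasSmoothExtensionPast 1 0 (drift (gI 1)) 1 ∧
    (∀ t ∈ Set.Ico (0 : ℝ) 1, ∀ (R : EuclideanSpace ℝ (Fin 3) ≃ₗᵢ[ℝ] EuclideanSpace ℝ (Fin 3)) (c : ℝ),
      ∫⁻ y : EuclideanSpace ℝ (Fin 2),
        ‖inner ℝ (Literature.Analysis.FluidPDE.curl (drift (gI 1) t) (R (WithLp.toLp 2 ![y 0, y 1, c])))
          (R (EuclideanSpace.single 2 1))‖ₑ ≤ ENNReal.ofReal M) := by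
  refine ⟨drift_isClassical (gI_contDiffOn 1) 1, drift_rapidDecay (gI_zero 1),
    drift_not_hasSmoothExtensionPast (tendsto_abs_gI_atTop 1 one_pos) 1, fun t _ R c => ?_⟩
  rw [drift_apply]
  exact flux_const_le _ R c M

/-- **Leray–Hopf is load-bearing modulo crux 3**: without it the crux IS `ZoomWitness = ¬ PlanarFluxLiouville`
(the drift makes the antecedent satisfiable). -/
theorem fluxZoomWithoutLerayHopf_iff : FluxZoomWithoutLerayHopf ↔ ZoomWitness := by
  constructor
  · intro h
    obtain ⟨hcl, hdec, hne, hflux⟩ := drift_passes 0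
    exact h 1 1 one_pos one_pos (drift (gI 1)) (driftP (gI 1)) hcl hdec hne ⟨0, hflux⟩
  · intro hW ν T _ _ u p _ _ _ _
    exact hW

/-- Packaged: crux 3 ⇒ `FluxZoom` is FALSE without Leray–Hopf. -/
theorem fluxZoom_false_without_LerayHopf_of_planarFluxLiouville (hL : PlanarFluxLiouville) :
    ¬ FluxZoomWithoutLerayHopf := fun h =>
  (zoomWitness_iff_not_planarFluxLiouville.1 (fluxZoomWithoutLerayHopf_iff.1 h)) hL

/-- `FluxZoom` with the no-extension hypothesis DROPPED. -/
def FluxZoomWithoutNoExtension : Prop :=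
  ∀ (ν T : ℝ), 0 < ν → 0 < T → ∀ (u : ℝ → EuclideanSpace ℝ (Fin 3) → EuclideanSpace ℝ (Fin 3))
    (p : ℝ → EuclideanSpace ℝ (Fin 3) → ℝ),
    Literature.Analysis.FluidPDE.IsClassicalNSSolutionOn (Set.Ico 0 T) ν 0 u p →
    Literature.Analysis.FluidPDE.IsLerayHopfOn T ν 0 (u 0) u →
    Literature.Analysis.FluidPDE.HasRapidSpatialDecay (u 0) →
    (∃ M : ℝ, ∀ t ∈ Set.Ico 0 T, ∀ (R : EuclideanSpace ℝ (Fin 3) ≃ₗᵢ[ℝ] EuclideanSpace ℝ (Fin 3)) (c : ℝ),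
      ∫⁻ y : EuclideanSpace ℝ (Fin 2),
        ‖inner ℝ (Literature.Analysis.FluidPDE.curl (u t) (R (WithLp.toLp 2 ![y 0, y 1, c])))
          (R (EuclideanSpace.single 2 1))‖ₑ ≤ ENNReal.ofReal M) →
    ZoomWitness

/-- The zero datum decays rapidly. -/
theorem hasRapidSpatialDecay_zero : Literature.Analysis.FluidPDE.HasRapidSpatialDecay (0 : ℝ³ → ℝ³) :=
  fun n K =>
  ⟨0, fun x => by
    have : iteratedFDeriv ℝ n (0 : ℝ³ → ℝ³) x = 0 := by
      rw [Pi.zero_def, iteratedFDeriv_fun_zero]; rfl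
    rw [this, norm_zero, mul_zero]⟩

/-- **The rest state passes every hypothesis of `FluxZoom` except no-extension** (any `ν`, `T`). -/
theorem rest_passes (ν T M : ℝ) :
    Literature.Analysis.FluidPDE.IsClassicalNSSolutionOn (Set.Ico 0 T) ν 0 (0 : ℝ → ℝ³ → ℝ³) 0 ∧
    Literature.Analysis.FluidPDE.IsLerayHopfOn T ν 0 ((0 : ℝ → ℝ³ → ℝ³) 0) 0 ∧
    Literature.Analysis.FluidPDE.HasRapidSpatialDecay ((0 : ℝ → ℝ³ → ℝ³) 0) ∧
    (∀ t ∈ Set.Ico (0 : ℝ) T, ∀ (R : EuclideanSpace ℝ (Fin 3) ≃ₗᵢ[ℝ] EuclideanSpace ℝ (Fin 3)) (c : ℝ),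
      ∫⁻ y : EuclideanSpace ℝ (Fin 2),
        ‖inner ℝ (Literature.Analysis.FluidPDE.curl ((0 : ℝ → ℝ³ → ℝ³) t) (R (WithLp.toLp 2 ![y 0, y 1, c])))
          (R (EuclideanSpace.single 2 1))‖ₑ ≤ ENNReal.ofReal M) := by
  refine ⟨isClassicalNSSolutionOn_zero _ _, by simpa using isLerayHopfOn_zero (E := ℝ³) T ν,
    by simpa using hasRapidSpatialDecay_zero, fun t _ R c => ?_⟩
  have h0 : ((0 : ℝ → ℝ³ → ℝ³) t) = fun _ => (0 : ℝ³) := rfl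
  rw [h0]
  exact flux_const_le _ R c M

/-- **No-extension is load-bearing modulo crux 3**: without it the crux IS `ZoomWitness`. -/
theorem fluxZoomWithoutNoExtension_iff : FluxZoomWithoutNoExtension ↔ ZoomWitness := by
  constructor
  · intro h
    obtain ⟨hcl, hLH, hdec, hflux⟩ := rest_passes 1 1 0
    exact h 1 1 one_pos one_pos 0 0 hcl hLH hdec ⟨0, hflux⟩
  · intro hW ν T _ _ u p _ _ _ _
    exact hW

/-- Packaged: crux 3 ⇒ `FluxZoom` is FALSE without the no-extension hypothesis. -/
theorem fluxZoom_false_without_noExtension_of_planarFluxLiouville (hL : PlanarFluxLiouville) :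
    ¬ FluxZoomWithoutNoExtension := fun h =>
  (zoomWitness_iff_not_planarFluxLiouville.1 (fluxZoomWithoutNoExtension_iff.1 h)) hL

/-- `FluxZoom` with the flux bound on `u` DROPPED. -/
def FluxZoomWithoutFluxBound : Prop :=
  ∀ (ν T : ℝ), 0 < ν → 0 < T → ∀ (u : ℝ → EuclideanSpace ℝ (Fin 3) → EuclideanSpace ℝ (Fin 3))
    (p : ℝ → EuclideanSpace ℝ (Fin 3) → ℝ),
    Literature.Analysis.FluidPDE.IsClassicalNSSolutionOn (Set.Ico 0 T) ν 0 u p →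
    Literature.Analysis.FluidPDE.IsLerayHopfOn T ν 0 (u 0) u →
    Literature.Analysis.FluidPDE.HasRapidSpatialDecay (u 0) →
    ¬ Literature.Analysis.FluidPDE.HasSmoothExtensionPast ν 0 u T →
    ZoomWitness

/-- **Dropping the flux bound on `u`** turns the crux into `PlanarFluxLiouville → NoBlowup`: the flux-class
Liouville theorem would have to yield FULL regularity (nothing left for crux 2 to do). -/
theorem fluxZoomWithoutFluxBound_iff : FluxZoomWithoutFluxBound ↔ (PlanarFluxLiouville → NoBlowup) := by
  constructor
  · intro h hL ν T hν hT u p hcl hLH hdec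
    by_contra hne
    exact (zoomWitness_iff_not_planarFluxLiouville.1 (h ν T hν hT u p hcl hLH hdec hne)) hL
  · intro h ν T hν hT u p hcl hLH hdec hne
    by_cases hL : PlanarFluxLiouville
    · exact absurd (h hL ν T hν hT u p hcl hLH hdec) hne
    · exact zoomWitness_iff_not_planarFluxLiouville.2 hL

/-! ## §4 Small redundancy in the conclusion -/

/-- The measurability conjunct of `ZoomWitness` follows from its joint-smoothness conjunct. -/
theorem aestronglyMeasurable_slice_of_contDiffOn {v : ℝ → ℝ³ → ℝ³}
    (h : ContDiffOn ℝ (⊤ : ℕ∞) (Function.uncurry v) (Set.Iio 0 ×ˢ Set.univ)) {t : ℝ} (ht : t < 0) :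
    MeasureTheory.AEStronglyMeasurable (v t) MeasureTheory.volume := by
  have hc : ContinuousOn (Function.uncurry v) (Set.Iio 0 ×ˢ Set.univ) := h.continuousOn
  have hslice : Continuous (v t) := by
    have h1 : Continuous fun x : ℝ³ => ((t, x) : ℝ × ℝ³) := continuous_const.prodMk continuous_id
    have h2 : ContinuousOn (fun x : ℝ³ => Function.uncurry v (t, x)) Set.univ :=
      hc.comp h1.continuousOn fun x _ => mk_mem_prod ht (mem_univ x)
    simpa [continuousOn_univ, Function.uncurry] using h2
  exact hslice.aestronglyMeasurable

/-! ## §5 Line `registered` — the lead's 7-stub skeleton (sha `aad79edc…`)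

### §5a The `L²` hypothesis of stubs 3–4 is load-bearing — LANDED (p151529, accepted, commit 0d1f68833b96):
`Theorems/FluxZoom/Negative/StubFluxVelocityFalseWithoutL2.lean`, imported above; re-exported here by name. -/

/-- **`stub_fluxVelocity` is FALSE without `v ∈ L²`** (constant field `e₀`, `W = Φ = 0`) — landed
`Theorems.FluxZoom.Negative.stub_fluxVelocity_false_without_L2`. -/
theorem stub_fluxVelocity_false_without_L2 :
    ¬ (∀ (v : EuclideanSpace ℝ (Fin 3) → EuclideanSpace ℝ (Fin 3)), ContDiff ℝ 2 v →
        Literature.Analysis.FluidPDE.VectorCalculus.IsDivFree v →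
        ∀ (W Φ : ℝ), 0 ≤ W → 0 ≤ Φ →
          (∀ x, ‖Literature.Analysis.FluidPDE.curl v x‖ ≤ W) →
          (∀ (R : EuclideanSpace ℝ (Fin 3) ≃ₗᵢ[ℝ] EuclideanSpace ℝ (Fin 3)) (c : ℝ),
            ∫⁻ y : EuclideanSpace ℝ (Fin 2),
              ‖inner ℝ (Literature.Analysis.FluidPDE.curl v (R (WithLp.toLp 2 ![y 0, y 1, c])))
                (R (EuclideanSpace.single 2 1))‖ₑ ≤ ENNReal.ofReal Φ) →
          ∀ x, ‖v x‖ ^ 2 ≤ 12 / Real.pi * W * Φ) :=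
  Summit.NavierStokesRegularity.NavierStokesRegularity.Theorems.FluxZoom.Negative.stub_fluxVelocity_false_without_L2

/-- **Boundedness cannot replace `L²` in `stub_fluxVelocity`** (same witness; the bounded ancient
LIMIT of the zoom is in exactly this class, so the velocity bound must be used before rescaling) —
landed `Theorems.FluxZoom.Negative.stub_fluxVelocity_false_with_bounded_for_L2`. -/
theorem stub_fluxVelocity_false_with_bounded_for_L2 :
    ¬ (∀ (v : EuclideanSpace ℝ (Fin 3) → EuclideanSpace ℝ (Fin 3)), ContDiff ℝ 2 v →
        Literature.Analysis.FluidPDE.VectorCalculus.IsDivFree v →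
        (∃ C : ℝ, ∀ x, ‖v x‖ ≤ C) →
        ∀ (W Φ : ℝ), 0 ≤ W → 0 ≤ Φ →
          (∀ x, ‖Literature.Analysis.FluidPDE.curl v x‖ ≤ W) →
          (∀ (R : EuclideanSpace ℝ (Fin 3) ≃ₗᵢ[ℝ] EuclideanSpace ℝ (Fin 3)) (c : ℝ),
            ∫⁻ y : EuclideanSpace ℝ (Fin 2),
              ‖inner ℝ (Literature.Analysis.FluidPDE.curl v (R (WithLp.toLp 2 ![y 0, y 1, c])))
                (R (EuclideanSpace.single 2 1))‖ₑ ≤ ENNReal.ofReal Φ) →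
          ∀ x, ‖v x‖ ^ 2 ≤ 12 / Real.pi * W * Φ) :=
  Summit.NavierStokesRegularity.NavierStokesRegularity.Theorems.FluxZoom.Negative.stub_fluxVelocity_false_with_bounded_for_L2

/-- **`stub_unitScaleVelocity` is FALSE without the `C_v‖v‖₂` term** (`r = 1`, `W = Φ = 0`, `e₀`) —
landed `Theorems.FluxZoom.Negative.stub_unitScaleVelocity_false_without_L2`. -/
theorem stub_unitScaleVelocity_false_without_L2 :
    ¬ (∀ (v : EuclideanSpace ℝ (Fin 3) → EuclideanSpace ℝ (Fin 3)), ContDiff ℝ 2 v →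
        Literature.Analysis.FluidPDE.VectorCalculus.IsDivFree v →
        ∀ (W Φ : ℝ), 0 ≤ W → 0 ≤ Φ →
          (∀ x, ‖Literature.Analysis.FluidPDE.curl v x‖ ≤ W) →
          (∀ (R : EuclideanSpace ℝ (Fin 3) ≃ₗᵢ[ℝ] EuclideanSpace ℝ (Fin 3)) (c : ℝ),
            ∫⁻ y : EuclideanSpace ℝ (Fin 2),
              ‖inner ℝ (Literature.Analysis.FluidPDE.curl v (R (WithLp.toLp 2 ![y 0, y 1, c])))
                (R (EuclideanSpace.single 2 1))‖ₑ ≤ ENNReal.ofReal Φ) →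
          ∀ (x : EuclideanSpace ℝ (Fin 3)) (r : ℝ), 0 < r → r ≤ 1 →
            ‖v x‖ ≤ r * W + 3 * Φ / (Real.pi * r)) :=
  Summit.NavierStokesRegularity.NavierStokesRegularity.Theorems.FluxZoom.Negative.stub_unitScaleVelocity_false_without_L2

/-- Sanity check of the optimisation behind `stub_fluxVelocity`'s constant `12/π`: if
`a ≤ ρ W + 3Φ/(π ρ)` for EVERY `ρ > 0` (`a, W, Φ ≥ 0`), then `a² ≤ (12/π) W Φ` — the choice
`ρ = (3Φ/(πW))^{1/2}` (AM–GM), with the degenerate cases `W = 0` (`ρ → ∞`) / `Φ = 0` (`ρ → 0`) forcing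
`a = 0`. Recorded for the prover (positive arithmetic, not a negative lemma). -/
theorem sq_le_of_forall_rho {a W Φ : ℝ} (ha : 0 ≤ a) (hW : 0 ≤ W) (hΦ : 0 ≤ Φ)
    (h : ∀ ρ : ℝ, 0 < ρ → a ≤ ρ * W + 3 * Φ / (Real.pi * ρ)) :
    a ^ 2 ≤ 12 / Real.pi * W * Φ := by
  have hπ : 0 < Real.pi := Real.pi_pos
  by_cases hW0 : W = 0
  · -- `a ≤ 3Φ/(πρ)` for all `ρ`: `a ≤ 0`
    subst hW0
    have ha0 : a ≤ 0 := by
      by_contra hpos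
      push Not at hpos
      -- take ρ large: ρ = 3Φ/(π a) + 1
      have key := h (3 * Φ / (Real.pi * a) * 2 + 1) (by positivity)
      rw [mul_zero, zero_add] at key
      have hρ : 0 < 3 * Φ / (Real.pi * a) * 2 + 1 := by positivity
      rw [le_div_iff₀ (by positivity)] at key
      -- a * (π * ρ) ≤ 3Φ but a π ρ = a π (6Φ/(π a) + 1) = 6Φ + aπ > 3Φ
      have : a * (Real.pi * (3 * Φ / (Real.pi * a) * 2 + 1)) = 6 * Φ + a * Real.pi := by
        field_simp
        ring
      rw [this] at key
      nlinarith [mul_pos hpos hπ]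
    have : a = 0 := le_antisymm ha0 ha
    subst this
    simp
  by_cases hΦ0 : Φ = 0
  · subst hΦ0
    have ha0 : a ≤ 0 := by
      by_contra hpos
      push Not at hpos
      have hWp : 0 < W := lt_of_le_of_ne hW (Ne.symm hW0)
      have key := h (a / (2 * W)) (by positivity)
      have h2 : a / (2 * W) * W = a / 2 := by
        field_simp
      simp only [mul_zero, zero_div, add_zero, h2] at key
      linarith
    have : a = 0 := le_antisymm ha0 ha
    subst this
    simp
  have hWp : 0 < W := lt_of_le_of_ne hW (Ne.symm hW0)
  have hΦp : 0 < Φ := lt_of_le_of_ne hΦ (Ne.symm hΦ0)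
  set ρ : ℝ := Real.sqrt (3 * Φ / (Real.pi * W)) with hρ
  have hρpos : 0 < ρ := Real.sqrt_pos.2 (by positivity)
  have hρsq : ρ ^ 2 = 3 * Φ / (Real.pi * W) := Real.sq_sqrt (by positivity)
  have key := h ρ hρpos
  -- at the optimum both terms equal ρ W, so a ≤ 2 ρ W and a² ≤ 4 ρ² W² = 12 W Φ / π
  have h2 : 3 * Φ / (Real.pi * ρ) = ρ * W := by
    rw [div_eq_iff (by positivity)]
    have : ρ * W * (Real.pi * ρ) = ρ ^ 2 * (Real.pi * W) := by ring
    rw [this, hρsq, div_mul_cancel₀ _ (by positivity)]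
  rw [h2] at key
  have hb : 0 ≤ ρ * W + ρ * W := by positivity
  calc a ^ 2 ≤ (ρ * W + ρ * W) ^ 2 := pow_le_pow_left₀ ha key 2
    _ = 4 * ρ ^ 2 * W ^ 2 := by ring
    _ = 12 / Real.pi * W * Φ := by rw [hρsq]; field_simp; ring

/-! ### §5b `stub_zoomCore` is glue-shaped: its conclusion is `u`-free -/

/-- `ZoomWitnessCurl`: the CONCLUSION of `stub_zoomCore`, verbatim — `ZoomWitness` with "non-constant
slice" strengthened to "a point of non-zero curl". A closed proposition (no `u`, `ν`, `T`, `M`). -/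
def ZoomWitnessCurl : Prop :=
  ∃ (v : ℝ → EuclideanSpace ℝ (Fin 3) → EuclideanSpace ℝ (Fin 3)) (M' : ℝ),
    Literature.Analysis.FluidPDE.IsBoundedAncientMildSolution 1 v ∧
    (∀ t < 0, MeasureTheory.AEStronglyMeasurable (v t) MeasureTheory.volume) ∧
    ContDiffOn ℝ (⊤ : ℕ∞) (Function.uncurry v) (Set.Iio 0 ×ˢ Set.univ) ∧
    (∀ t < 0, ∀ (R : EuclideanSpace ℝ (Fin 3) ≃ₗᵢ[ℝ] EuclideanSpace ℝ (Fin 3)) (c : ℝ),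
      ∫⁻ y : EuclideanSpace ℝ (Fin 2),
        ‖inner ℝ (Literature.Analysis.FluidPDE.curl (v t) (R (WithLp.toLp 2 ![y 0, y 1, c])))
          (R (EuclideanSpace.single 2 1))‖ₑ ≤ ENNReal.ofReal M') ∧
    ∃ t < 0, ∃ x, Literature.Analysis.FluidPDE.curl (v t) x ≠ 0

/-- `BoundedFluxVorticityBlowup`: SATISFIABILITY of the `u`-antecedent of `stub_zoomCore` — a classical
Leray–Hopf solution from a rapidly decaying datum with bounded planar flux on `[0,T)`, velocity and
vorticity bounded on closed sub-slabs, and vorticity UNBOUNDED on `[0,T) × ℝ³` (a finite-time vorticity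
blow-up from Schwartz-class data, at bounded flux). -/
def BoundedFluxVorticityBlowup : Prop :=
  ∃ (ν T : ℝ), 0 < ν ∧ 0 < T ∧
    ∃ (u : ℝ → EuclideanSpace ℝ (Fin 3) → EuclideanSpace ℝ (Fin 3)) (p : ℝ → EuclideanSpace ℝ (Fin 3) → ℝ),
      Literature.Analysis.FluidPDE.IsClassicalNSSolutionOn (Set.Ico 0 T) ν 0 u p ∧
      Literature.Analysis.FluidPDE.IsLerayHopfOn T ν 0 (u 0) u ∧
      Literature.Analysis.FluidPDE.HasRapidSpatialDecay (u 0) ∧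
      (∃ M : ℝ, ∀ t ∈ Set.Ico 0 T,
        ∀ (R : EuclideanSpace ℝ (Fin 3) ≃ₗᵢ[ℝ] EuclideanSpace ℝ (Fin 3)) (c : ℝ),
          ∫⁻ y : EuclideanSpace ℝ (Fin 2),
            ‖inner ℝ (Literature.Analysis.FluidPDE.curl (u t) (R (WithLp.toLp 2 ![y 0, y 1, c])))
              (R (EuclideanSpace.single 2 1))‖ₑ ≤ ENNReal.ofReal M) ∧
      (∀ T' ∈ Set.Ioo 0 T, ∃ B : ℝ, ∀ t ∈ Set.Icc 0 T', ∀ x,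
        ‖u t x‖ ≤ B ∧ ‖Literature.Analysis.FluidPDE.curl (u t) x‖ ≤ B) ∧
      ¬ ∃ W : ℝ, ∀ t ∈ Set.Ico 0 T, ∀ x, ‖Literature.Analysis.FluidPDE.curl (u t) x‖ ≤ W

/-- `StubZoomCoreU`: the `u`-part of `stub_zoomCore`, verbatim (the registered stub is
`S4 → S5 → S6 → StubZoomCoreU` with `S4, S5, S6` the statements of stubs 4–6, all TRUE: scaling,
`KNSS2009_mild_regularity_holds`, Oseen ⇒ duality). -/
def StubZoomCoreU : Prop :=
  ∀ (ν T : ℝ), 0 < ν → 0 < T →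
    ∀ (u : ℝ → EuclideanSpace ℝ (Fin 3) → EuclideanSpace ℝ (Fin 3))
      (p : ℝ → EuclideanSpace ℝ (Fin 3) → ℝ),
      Literature.Analysis.FluidPDE.IsClassicalNSSolutionOn (Set.Ico 0 T) ν 0 u p →
      Literature.Analysis.FluidPDE.IsLerayHopfOn T ν 0 (u 0) u →
      Literature.Analysis.FluidPDE.HasRapidSpatialDecay (u 0) →
      (∃ M : ℝ, ∀ t ∈ Set.Ico 0 T,
        ∀ (R : EuclideanSpace ℝ (Fin 3) ≃ₗᵢ[ℝ] EuclideanSpace ℝ (Fin 3)) (c : ℝ),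
          ∫⁻ y : EuclideanSpace ℝ (Fin 2),
            ‖inner ℝ (Literature.Analysis.FluidPDE.curl (u t) (R (WithLp.toLp 2 ![y 0, y 1, c])))
              (R (EuclideanSpace.single 2 1))‖ₑ ≤ ENNReal.ofReal M) →
      (∀ T' ∈ Set.Ioo 0 T, ∃ B : ℝ, ∀ t ∈ Set.Icc 0 T', ∀ x,
        ‖u t x‖ ≤ B ∧ ‖Literature.Analysis.FluidPDE.curl (u t) x‖ ≤ B) →
      (¬ ∃ W : ℝ, ∀ t ∈ Set.Ico 0 T, ∀ x, ‖Literature.Analysis.FluidPDE.curl (u t) x‖ ≤ W) →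
      ∃ (v : ℝ → EuclideanSpace ℝ (Fin 3) → EuclideanSpace ℝ (Fin 3)) (M' : ℝ),
        Literature.Analysis.FluidPDE.IsBoundedAncientMildSolution 1 v ∧
        (∀ t < 0, MeasureTheory.AEStronglyMeasurable (v t) MeasureTheory.volume) ∧
        ContDiffOn ℝ (⊤ : ℕ∞) (Function.uncurry v) (Set.Iio 0 ×ˢ Set.univ) ∧
        (∀ t < 0, ∀ (R : EuclideanSpace ℝ (Fin 3) ≃ₗᵢ[ℝ] EuclideanSpace ℝ (Fin 3)) (c : ℝ),
          ∫⁻ y : EuclideanSpace ℝ (Fin 2),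
            ‖inner ℝ (Literature.Analysis.FluidPDE.curl (v t) (R (WithLp.toLp 2 ![y 0, y 1, c])))
              (R (EuclideanSpace.single 2 1))‖ₑ ≤ ENNReal.ofReal M') ∧
        ∃ t < 0, ∃ x, Literature.Analysis.FluidPDE.curl (v t) x ≠ 0

/-- **`StubZoomCoreU ↔ (BoundedFluxVorticityBlowup → ZoomWitnessCurl)`**: the core stub, like the
crux, is the bare implication "a bounded-flux vorticity blow-up anywhere ⇒ the (u-free) witness". -/
theorem stubZoomCoreU_iff : StubZoomCoreU ↔ (BoundedFluxVorticityBlowup → ZoomWitnessCurl) := by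
  constructor
  · rintro h ⟨ν, T, hν, hT, u, p, hcl, hLH, hdec, hflux, hsub, hunb⟩
    exact h ν T hν hT u p hcl hLH hdec hflux hsub hunb
  · intro h ν T hν hT u p hcl hLH hdec hflux hsub hunb
    exact h ⟨ν, T, hν, hT, u, p, hcl, hLH, hdec, hflux, hsub, hunb⟩

/-- Slices of a jointly smooth field on `(−∞,0) × ℝ³` are smooth. -/
theorem contDiff_slice_of_contDiffOn {v : ℝ → ℝ³ → ℝ³}
    (h : ContDiffOn ℝ (⊤ : ℕ∞) (Function.uncurry v) (Set.Iio 0 ×ˢ Set.univ)) {t : ℝ} (ht : t < 0) :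
    ContDiff ℝ (⊤ : ℕ∞) (v t) :=
  Literature.Analysis.FluidPDE.IsSmoothSpaceTimeOn.contDiff_slice (S := Set.Iio 0) h ht

/-- **`ZoomWitnessCurl ↔ ZoomWitness`**: for a bounded ancient mild solution with smooth slices,
"non-constant on the slice `t`" and "a point of non-zero curl on the slice `t`" are equivalent — a
bounded, smooth, weakly divergence-free, irrotational field is constant (KNSS 2009 Lemma 3.1; landed as
`Theorems.PlanarFluxLiouville.Birth.stub_irrotationalConstant`), and a constant slice has zero curl. So
the lead's strengthened conclusion costs nothing. -/
theorem zoomWitnessCurl_iff_zoomWitness : ZoomWitnessCurl ↔ ZoomWitness := by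
  constructor
  · rintro ⟨v, M', hv, hmeas, hsm, hflux, t, ht, x, hx⟩
    refine ⟨v, M', hv, hmeas, hsm, hflux, t, ht, ?_⟩
    rintro ⟨b, hb⟩
    apply hx
    have hconst : v t = fun _ => b := funext hb
    rw [hconst]
    exact curl_const b x
  · rintro ⟨v, M', hv, hmeas, hsm, hflux, t, ht, hnc⟩
    refine ⟨v, M', hv, hmeas, hsm, hflux, t, ht, ?_⟩
    by_contra hzero
    push Not at hzero
    obtain ⟨C, hC⟩ := hv.2
    exact hnc (Summit.NavierStokesRegularity.NavierStokesRegularity.Theorems.PlanarFluxLiouville.Birth.stub_irrotationalConstant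
      (v t) (contDiff_slice_of_contDiffOn hsm ht) (hv.1.1 t ht) ⟨C, fun x => hC t ht x⟩ hzero)

/-- Hence `ZoomWitnessCurl ↔ ¬ PlanarFluxLiouville` as well. -/
theorem zoomWitnessCurl_iff_not_planarFluxLiouville : ZoomWitnessCurl ↔ ¬ PlanarFluxLiouville :=
  zoomWitnessCurl_iff_zoomWitness.trans zoomWitness_iff_not_planarFluxLiouville

/-- **What a refutation of the lead's core stub must deliver**: a bounded-flux finite-time VORTICITY
blow-up from Schwartz-class data AND crux 3. Neither is within reach (the first is a negative answer to
the regularity problem in BKM form); the stub is unkillable for the same reason as the crux. -/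
theorem not_stubZoomCoreU_iff :
    ¬ StubZoomCoreU ↔ (BoundedFluxVorticityBlowup ∧ PlanarFluxLiouville) := by
  rw [stubZoomCoreU_iff, zoomWitnessCurl_iff_not_planarFluxLiouville]
  constructor
  · intro h
    by_contra h'
    exact h fun hB hL => h' ⟨hB, hL⟩
  · rintro ⟨hB, hL⟩ h
    exact h hB hL

/-- If crux 3 is false the core stub holds trivially (its `u`-hypotheses are never used). -/
theorem stubZoomCoreU_of_not_planarFluxLiouville (h : ¬ PlanarFluxLiouville) : StubZoomCoreU :=
  stubZoomCoreU_iff.2 fun _ => zoomWitnessCurl_iff_not_planarFluxLiouville.2 h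

/-- **A bounded-flux blow-up (no smooth extension) is a bounded-flux VORTICITY blow-up**, by the
LANDED stub 1 (`Theorems.FluxZoom.Registered.stub_subslabBounds`: sup-form BKM (a) and sub-slab
bounds (b)). This is the `u`-side of the skeleton's composition `FluxZoom_of`. -/
theorem boundedFluxVorticityBlowup_of_not_boundedFluxNoBlowup (h : ¬ BoundedFluxNoBlowup) :
    BoundedFluxVorticityBlowup := by
  by_contra hB
  apply h
  intro ν T hν hT u p hcl hLH hdec hflux
  obtain ⟨hbkm, hsub⟩ :=
    Summit.NavierStokesRegularity.NavierStokesRegularity.Theorems.FluxZoom.Registered.stub_subslabBounds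
      ν T hν hT u p hcl hLH hdec
  by_contra hne
  exact hB ⟨ν, T, hν, hT, u, p, hcl, hLH, hdec, hflux, hsub, fun hW => hne (hbkm hW)⟩

/-- **The composition, re-certified**: the `u`-part of the core stub alone implies the crux (stubs 1–2
landed, stubs 3–6 enter `stub_zoomCore` only as antecedents). -/
theorem fluxZoom_of_stubZoomCoreU (h : StubZoomCoreU) : FluxZoom := by
  rw [fluxZoom_iff_not_boundedFluxNoBlowup_imp]
  intro hB
  exact zoomWitnessCurl_iff_zoomWitness.1
    (stubZoomCoreU_iff.1 h (boundedFluxVorticityBlowup_of_not_boundedFluxNoBlowup hB))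

/-- The sub-slab-bounds hypothesis of `stub_zoomCore` is a CONVENIENCE, not load-bearing: it is implied
by the class hypotheses (landed stub 1 (b)), so the stub with it deleted is equivalent. -/
theorem stubZoomCoreU_iff_without_subslab :
    StubZoomCoreU ↔
      (∀ (ν T : ℝ), 0 < ν → 0 < T →
        ∀ (u : ℝ → EuclideanSpace ℝ (Fin 3) → EuclideanSpace ℝ (Fin 3))
          (p : ℝ → EuclideanSpace ℝ (Fin 3) → ℝ),
          Literature.Analysis.FluidPDE.IsClassicalNSSolutionOn (Set.Ico 0 T) ν 0 u p →
          Literature.Analysis.FluidPDE.IsLerayHopfOn T ν 0 (u 0) u →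
          Literature.Analysis.FluidPDE.HasRapidSpatialDecay (u 0) →
          (∃ M : ℝ, ∀ t ∈ Set.Ico 0 T,
            ∀ (R : EuclideanSpace ℝ (Fin 3) ≃ₗᵢ[ℝ] EuclideanSpace ℝ (Fin 3)) (c : ℝ),
              ∫⁻ y : EuclideanSpace ℝ (Fin 2),
                ‖inner ℝ (Literature.Analysis.FluidPDE.curl (u t) (R (WithLp.toLp 2 ![y 0, y 1, c])))
                  (R (EuclideanSpace.single 2 1))‖ₑ ≤ ENNReal.ofReal M) →
          (¬ ∃ W : ℝ, ∀ t ∈ Set.Ico 0 T, ∀ x, ‖Literature.Analysis.FluidPDE.curl (u t) x‖ ≤ W) →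
          ZoomWitnessCurl) := by
  constructor
  · intro h ν T hν hT u p hcl hLH hdec hflux hunb
    obtain ⟨-, hsub⟩ :=
      Summit.NavierStokesRegularity.NavierStokesRegularity.Theorems.FluxZoom.Registered.stub_subslabBounds
        ν T hν hT u p hcl hLH hdec
    exact h ν T hν hT u p hcl hLH hdec hflux hsub hunb
  · intro h ν T hν hT u p hcl hLH hdec hflux _ hunb
    exact h ν T hν hT u p hcl hLH hdec hflux hunb

/-- The hypothesis "vorticity unbounded on `[0,T)`" of `stub_zoomCore` is load-bearing MODULO crux 3:
with it deleted, the rest state (§3 `rest_passes`, sub-slab bounds `B = 0`) makes the antecedent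
satisfiable, so the stub collapses to `ZoomWitnessCurl = ¬ PlanarFluxLiouville`. -/
theorem stubZoomCoreU_without_unbounded_iff :
    (∀ (ν T : ℝ), 0 < ν → 0 < T →
        ∀ (u : ℝ → EuclideanSpace ℝ (Fin 3) → EuclideanSpace ℝ (Fin 3))
          (p : ℝ → EuclideanSpace ℝ (Fin 3) → ℝ),
          Literature.Analysis.FluidPDE.IsClassicalNSSolutionOn (Set.Ico 0 T) ν 0 u p →
          Literature.Analysis.FluidPDE.IsLerayHopfOn T ν 0 (u 0) u →
          Literature.Analysis.FluidPDE.HasRapidSpatialDecay (u 0) →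
          (∃ M : ℝ, ∀ t ∈ Set.Ico 0 T,
            ∀ (R : EuclideanSpace ℝ (Fin 3) ≃ₗᵢ[ℝ] EuclideanSpace ℝ (Fin 3)) (c : ℝ),
              ∫⁻ y : EuclideanSpace ℝ (Fin 2),
                ‖inner ℝ (Literature.Analysis.FluidPDE.curl (u t) (R (WithLp.toLp 2 ![y 0, y 1, c])))
                  (R (EuclideanSpace.single 2 1))‖ₑ ≤ ENNReal.ofReal M) →
          (∀ T' ∈ Set.Ioo 0 T, ∃ B : ℝ, ∀ t ∈ Set.Icc 0 T', ∀ x,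
            ‖u t x‖ ≤ B ∧ ‖Literature.Analysis.FluidPDE.curl (u t) x‖ ≤ B) →
          ZoomWitnessCurl) ↔ ZoomWitnessCurl := by
  constructor
  · intro h
    obtain ⟨hcl, hLH, hdec, hflux⟩ := rest_passes 1 1 0
    refine h 1 1 one_pos one_pos 0 0 hcl hLH hdec ⟨0, hflux⟩ fun T' _ => ⟨0, fun t _ x => ⟨by simp, ?_⟩⟩
    have h0 : ((0 : ℝ → ℝ³ → ℝ³) t) = fun _ => (0 : ℝ³) := rfl
    rw [h0, curl_const, norm_zero]
  · intro hW ν T _ _ u p _ _ _ _ _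
    exact hW

/-! ### §5c The crux hypothesis `0 < T` is decoration -/

/-- For `T ≤ 0` EVERY velocity field "extends smoothly past `T`": the interval `[0, T)` is empty, and
the rest state on `[0, 1)` (if `T = 0`; on the empty `[0, 0)` if `T < 0`) is a classical extension. -/
theorem hasSmoothExtensionPast_of_nonpos {ν T : ℝ} (hT : T ≤ 0) (u : ℝ → ℝ³ → ℝ³) :
    Literature.Analysis.FluidPDE.HasSmoothExtensionPast ν 0 u T := by
  refine ⟨1, by linarith, 0, 0, isClassicalNSSolutionOn_zero _ _, fun t ht => ?_⟩
  exact absurd (lt_of_le_of_lt ht.1 ht.2) (not_lt.2 hT)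

/-- Hence `¬ HasSmoothExtensionPast ν 0 u T → 0 < T`: in `FluxZoom` (and in `BoundedFluxNoBlowup`'s
contrapositive reading) the hypothesis `0 < T` is implied by the no-extension hypothesis. -/
theorem pos_of_not_hasSmoothExtensionPast {ν T : ℝ} {u : ℝ → ℝ³ → ℝ³}
    (h : ¬ Literature.Analysis.FluidPDE.HasSmoothExtensionPast ν 0 u T) : 0 < T := by
  by_contra hT
  exact h (hasSmoothExtensionPast_of_nonpos (not_lt.1 hT) u)

/-- `FluxZoom` with `0 < T` deleted is EQUIVALENT to `FluxZoom`. -/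
theorem fluxZoom_iff_without_T_pos :
    FluxZoom ↔
      (∀ (ν T : ℝ), 0 < ν →
        ∀ (u : ℝ → EuclideanSpace ℝ (Fin 3) → EuclideanSpace ℝ (Fin 3))
          (p : ℝ → EuclideanSpace ℝ (Fin 3) → ℝ),
          Literature.Analysis.FluidPDE.IsClassicalNSSolutionOn (Set.Ico 0 T) ν 0 u p →
          Literature.Analysis.FluidPDE.IsLerayHopfOn T ν 0 (u 0) u →
          Literature.Analysis.FluidPDE.HasRapidSpatialDecay (u 0) →
          ¬ Literature.Analysis.FluidPDE.HasSmoothExtensionPast ν 0 u T →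
          (∃ M : ℝ, ∀ t ∈ Set.Ico 0 T,
            ∀ (R : EuclideanSpace ℝ (Fin 3) ≃ₗᵢ[ℝ] EuclideanSpace ℝ (Fin 3)) (c : ℝ),
              ∫⁻ y : EuclideanSpace ℝ (Fin 2),
                ‖inner ℝ (Literature.Analysis.FluidPDE.curl (u t) (R (WithLp.toLp 2 ![y 0, y 1, c])))
                  (R (EuclideanSpace.single 2 1))‖ₑ ≤ ENNReal.ofReal M) →
          ZoomWitness) := by
  constructor
  · intro h ν T hν u p hcl hLH hdec hne hflux
    exact h ν T hν (pos_of_not_hasSmoothExtensionPast hne) u p hcl hLH hdec hne hflux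
  · intro h ν T hν _ u p hcl hLH hdec hne hflux
    exact h ν T hν u p hcl hLH hdec hne hflux

end Summit.NavierStokesRegularity.NavierStokesRegularity.Cruxes.FluxZoom.Disproof

end
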